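import Summits.BirchSwinnertonDyer.BirchSwinnertonDyer.Theorems.KimAtThreeD7uKolyvaginPairBlochKato
import Summits.BirchSwinnertonDyer.Rank1Residual.GaloisImage.KummerConditionUnramifiedTamagawaFree
import Summits.BirchSwinnertonDyer.Rank1Residual.GaloisImage.PropagatedStructureUnramified
import HarnessLib

/-!
# The TAMAGAWA-FREE bad places, I: the E-specific local algebra — at a finite `w ∤ p` with
# `p ∤ c_w = [E(ℚ_w) : E₀(ℚ_w)]`, `E[p^{k+1}]^{I_w} = π_{k+1}(T_pE^{I_w}) + (Frob_w − 1) E[p^{k+1}]^{I_w}`,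
# and every `I_w`-vanishing cocycle of `E[p^{k+1}]` is the reduction of an UNRAMIFIED class of `T_pE`
# (cell `bsd-addord`, seat w2-tamdiv gen 3; route W2 `KimAtThreeKolyvagin`, items 19562 / 19560, «TamDiv∞»)

HONEST FRAMING: TOOL theorems (no definition, no named fact, no `sorry`); closes nothing by itself;
nothing is booked; BSD is not proved by any of this.  Seat gen 2 landed [MR04] Remark A.5 for `T_pE`
(`KimAtThreeD7uKolyvaginPairBlochKato`: Kato-type classes form Kolyvagin systems for
`𝓕_u = blochKatoSelmerStructure p (tateTorsionDatum W p k) ⊤`) and `𝓕_u ≤ 𝓕_can`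
(`KimAtThreeD7uBlochKatoCondition.blochKatoSelmerStructure_inr_le_propagatedSelmerStructure`), leaving
the E-SPECIFIC Tamagawa factor `[𝓕_can(w) : 𝓕_u(w)] = (c_w)_p` (Rubin, *Euler Systems*, Lemma 1.3.5;
Büyükboduk, JNT 129 (2009) §2.1.2 Remark 2) open; w2-acc5 g3 supplied its E-free half
(`KimAtThreeDeepUpperOffStratumLocalIndex`).  This file and its sequel
`KimAtThreeD7uTamagawaFreeStructures` prove the EXPONENT-ZERO case in the tree's currency
`localTamagawaNumber` (`c_w = [E(ℚ_w) : E₀(ℚ_w)]`, `Tamagawa.lean`): **if `p ∤ c_w` then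
`𝓕_u(w) = 𝓕_can(w) = H¹_ur(ℚ_w, E[p^{k+1}])` for every `k`** — Büyükboduk's hypothesis H.T («`p` does
not divide any Tamagawa number») is exactly where [MR04] Remark A.5 costs nothing; the Tamagawa defect
of an Euler system of `T_pE` lives at the places with `p ∣ c_w` only.  Here: the local algebra.

## What

* §1 (any number field `K`, `𝔓₀`-form of n1011's rows T-ROOT / T-URTAM): at a finite `v ∤ p` with
  `p ∤ c_v`, for an arithmetic Frobenius `φ` at `𝔓₀ = adicCompletionPrime K v`:
  `exists_divSeq_inertia_of_decomposition_fixed` — a `D_{𝔓₀}`-fixed point of `E[p^∞]` has a COMPATIBLE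
  sequence of `I_{𝔓₀}`-fixed `p`-power roots ((ROOT) `rootable_adicCompletionPrime_of_not_dvd_localTamagawaNumber`
  + the divisible core `exists_nsmul_eq_of_forall_exists_pow_nsmul_eq`);
  **`exists_tate_inertia_add_frob_sub_of_not_dvd_localTamagawaNumber`** — every `I_{𝔓₀}`-fixed
  `p^{k+1}`-torsion point `m` is `a_{k+1} + (φ b − b)` with `a ∈ T_pE^{I_{𝔓₀}}` and `b` an
  `I_{𝔓₀}`-fixed `p^{k+1}`-torsion point (`φ − 1` is ONTO `E[p^∞]^{I}` under (ROOT), n1011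
  `exists_frob_smul_sub_eq_of_rootable`; `p^{k+1} b₀` is `D_{𝔓₀}`-fixed and its compatible root sequence
  `s` gives `a = (φ s_n − s_n)_n`), i.e. `E[p^{k+1}]^{I} = π_{k+1}(T_pE^{I}) + (φ − 1) E[p^{k+1}]^{I}` —
  the vanishing of `(E[p^{k+1}]^{I}/π_{k+1} T^{I})^{Fr} ⊆ H¹(I_w, T_pE)^{Fr}[p^{k+1}]`, the `p`-part of
  the Tamagawa factor.
* §2 (`K = ℚ`): **`exists_unramified_tateLocalMap_eq_of_vanishing_inertia_of_not_dvd_localTamagawaNumber`**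
  — at a finite `w ∤ p` with `p ∤ c_w`, every continuous cocycle `ψ : Γ_{ℚ_w} → E[p^k · p]` vanishing on
  `I_w` has class `π_{k+1,*} y` with `y ∈ H¹(ℚ_w, T_pE)` unramified (`res_{I_w} y = 0`): gen 2's local
  `𝓕_u` lift `exists_unramified_tateLocalMap_eq_of_vanishing_inertia` after correcting `ψ` by the
  coboundary `∂b` of §1.  The sequel turns this into `𝓕_u(w) = 𝓕_can(w)`.

HONEST LIMITS: the positive-exponent index (`p ∣ c_w ⇒ 𝓕_u(w) ⊊ 𝓕_can(w)`,
`#(𝓕_can(w)/𝓕_u(w)) = p^{min(k+1, v_p c_w)}`) is NOT here.  References: K. Rubin, *Euler Systems* (2000)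
Lemma 1.3.2, 1.3.5; B. Mazur, K. Rubin, Mem. AMS 799 (2004) Prop. 6.2.6, App. A Remark A.5;
K. Büyükboduk, JNT 129 (2009) §2.1.2 Remark 2, §3; D. Jetchev, Compos. Math. 144 (2008) Lemma 4.3;
R. Greenberg, LNM 1716 (1999) §3 (remark after Lemma 3.3); J. S. Milne, *ADT* I Prop. 3.8.
-/

noncomputable section

-- the cell's Theorems namespace `Summit.BirchSwinnertonDyer.BirchSwinnertonDyer.…` repeats the summit name by design (D-0017)
set_option linter.dupNamespace false

open CategoryTheory Function Field IsDedekindDomain NumberField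
open scoped NumberField Classical
open Literature.NumberTheory.GaloisRepresentations Literature.NumberTheory.EllipticCurves
open Literature.NumberTheory.GaloisRepresentations.DiscreteGaloisModule (unramifiedSubgroup)
open Literature.NumberTheory.GaloisRepresentations.IsNonarchimedeanLocalField
open WeierstrassCurve
open Summit.BirchSwinnertonDyer.Rank1Residual.GaloisImage
open Summit.BirchSwinnertonDyer.Rank1Residual.GaloisImage.InertiaDivisible
open Summit.BirchSwinnertonDyer.Rank1Residual.GaloisImage.Derivative.Transverse.Rat
open Summit.BirchSwinnertonDyer.Rank1Residual.X11b
open Summit.BirchSwinnertonDyer.BirchSwinnertonDyer.Theorems.KimAtThreeD7uUnramifiedMembership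
open Summit.BirchSwinnertonDyer.BirchSwinnertonDyer.Theorems.KimAtThreeD7uBlochKatoCondition
open Summit.BirchSwinnertonDyer.BirchSwinnertonDyer.Theorems.KimAtThreeD7uKolyvaginPairBlochKato

namespace Summit.BirchSwinnertonDyer.BirchSwinnertonDyer.Theorems.KimAtThreeD7uTamagawaFreePlaces

/-! ### §1 The E-specific local algebra at a Tamagawa-free place (`𝔓₀`-form, any number field) -/

section LocalAlgebra

variable {K : Type} [Field K] [NumberField K] (W : WeierstrassCurve K) [W.IsElliptic] (p : ℕ)
  [hp : Fact p.Prime]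

omit [NumberField K] in
/-- The `p`-torsion layer of `E[p^∞]` is finite (it injects into `E[p]`, Silverman III.6.4).
[cite: SilvermanAEC2009, Cor. III.6.4] -/
theorem finite_setOf_smul_eq_zero_geomPrimaryTorsion :
    {t : W.geomPrimaryTorsion p | p • t = 0}.Finite := by
  have hne : ((p : ℕ) : ℤ) ≠ 0 := by exact_mod_cast hp.out.ne_zero
  haveI : Finite (geomTorsion W ((p : ℕ) : ℤ)) := finite_torsionPoints_holds W (AlgebraicClosure K) hne
  let f : {t : W.geomPrimaryTorsion p | p • t = 0} → geomTorsion W ((p : ℕ) : ℤ) := fun t =>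
    ⟨((t : W.geomPrimaryTorsion p) : geomPoints W), by
      rw [mem_geomTorsion_iff, natCast_zsmul]
      have h := t.2
      simp only [Set.mem_setOf_eq] at h
      have h' := congrArg (fun z : W.geomPrimaryTorsion p => (z : geomPoints W)) h
      simpa only [AddSubmonoidClass.coe_nsmul, ZeroMemClass.coe_zero] using h'⟩
  refine Set.finite_coe_iff.mp (Finite.of_injective f fun a b hab => ?_)
  have h := congrArg (fun z : geomTorsion W ((p : ℕ) : ℤ) => (z : geomPoints W)) hab
  exact Subtype.ext (Subtype.ext h)

/-- **Compatible `I_{𝔓₀}`-fixed division sequences at a Tamagawa-free place.**  At a finite `v ∤ p`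
with `p ∤ c_v`, a point `t` of `E[p^∞]` fixed by the decomposition group `D_{𝔓₀}` of
`𝔓₀ = adicCompletionPrime K v` admits a sequence `s : ℕ → E[p^∞]` with `s 0 = t`,
`p • s (n+1) = s n` and every `s n` fixed by the inertia group `I_{𝔓₀}`: (ROOT)
(`rootable_adicCompletionPrime_of_not_dvd_localTamagawaNumber`: `t` has `I_{𝔓₀}`-fixed `p^k`-th roots
for every `k`) places `t` in the `p`-DIVISIBLE core of `E[p^∞]^{I_{𝔓₀}}`
(`exists_nsmul_eq_of_forall_exists_pow_nsmul_eq`), along which roots are chosen recursively.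
[cite: GreenbergLNM1716, §3 Lemma 3.3 (p. 87) with the remark after its proof (p. 88)]
[cite: MilneADT2006, Ch. I Prop. 3.8 and Remark 3.10] -/
theorem exists_divSeq_inertia_of_decomposition_fixed {v : HeightOneSpectrum (𝓞 K)}
    (hpv : (p : 𝓞 K) ∉ v.asIdeal)
    (hc : ¬ p ∣ (W.baseChange (v.adicCompletion K)).localTamagawaNumber (v.adicCompletionIntegers K))
    (t : W.geomPrimaryTorsion p)
    (ht : ∀ d ∈ (adicCompletionPrime K v).decompositionSubgroup (absoluteGaloisGroup K), d • t = t) :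
    ∃ s : ℕ → W.geomPrimaryTorsion p, s 0 = t ∧ (∀ n, p • s (n + 1) = s n) ∧
      ∀ n, ∀ i ∈ (adicCompletionPrime K v).inertia (absoluteGaloisGroup K), i • s n = s n := by
  set I : Subgroup (absoluteGaloisGroup K) := (adicCompletionPrime K v).inertia (absoluteGaloisGroup K)
    with hIdef
  -- the subgroup `N = E[p^∞]^I`
  let N : AddSubgroup (W.geomPrimaryTorsion p) :=
    { carrier := {x | ∀ i ∈ I, i • x = x}
      add_mem' := fun {a b} ha hb i hi ↦ by rw [smul_add, ha i hi, hb i hi]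
      zero_mem' := fun i _ ↦ smul_zero i
      neg_mem' := fun {a} ha i hi ↦ by rw [smul_neg, ha i hi] }
  have hNmem : ∀ x : W.geomPrimaryTorsion p, x ∈ N ↔ ∀ i ∈ I, i • x = x := fun _ ↦ Iff.rfl
  -- the core property: in `N` with `p^k`-th roots in `N` for every `k`
  let P : W.geomPrimaryTorsion p → Prop := fun x => x ∈ N ∧ ∀ k : ℕ, ∃ y ∈ N, p ^ k • y = x
  have hfin := finite_setOf_smul_eq_zero_geomPrimaryTorsion W p
  have hstep : ∀ x, P x → ∃ y, p • y = x ∧ P y := by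
    rintro x ⟨-, hx⟩
    obtain ⟨y, hyN, hpy, hy⟩ := exists_nsmul_eq_of_forall_exists_pow_nsmul_eq N hfin hx
    exact ⟨y, hpy, hyN, hy⟩
  -- `t` has the core property by (ROOT)
  have hI_le : I ≤ (adicCompletionPrime K v).decompositionSubgroup (absoluteGaloisGroup K) :=
    Ideal.inertia_le_decompositionSubgroup _ _
  have hPt : P t := by
    refine ⟨fun i hi => ht i (hI_le hi), fun k => ?_⟩
    obtain ⟨s, hs, hps⟩ :=
      rootable_adicCompletionPrime_of_not_dvd_localTamagawaNumber W p hpv hc t ht k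
    exact ⟨s, hs, hps⟩
  -- recursive choice of roots inside the core
  let step : {x // P x} → {x // P x} := fun x =>
    ⟨Classical.choose (hstep x.1 x.2), (Classical.choose_spec (hstep x.1 x.2)).2⟩
  have hstep' : ∀ x : {x // P x}, p • (step x).1 = x.1 := fun x =>
    (Classical.choose_spec (hstep x.1 x.2)).1
  let s : ℕ → {x // P x} := fun n => Nat.rec ⟨t, hPt⟩ (fun _ x => step x) n
  refine ⟨fun n => (s n).1, rfl, fun n => hstep' (s n), fun n => (s n).2.1⟩

/-- **`E[p^{k+1}]^{I} = π_{k+1}(T_pE^{I}) + (φ − 1) E[p^{k+1}]^{I}` at a Tamagawa-free place.**  At a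
finite `v ∤ p` with `p ∤ c_v`, for an arithmetic Frobenius `φ` at `𝔓₀ = adicCompletionPrime K v`:
every `I_{𝔓₀}`-fixed point `m` of `E[p^∞]` killed by `p^{k+1}` is
`m = a_{k+1} + (φ • b − b)` with `a ∈ T_pE` fixed by `I_{𝔓₀}` (componentwise) and `b ∈ E[p^∞]` fixed by
`I_{𝔓₀}` and killed by `p^{k+1}`.  PROOF: `φ − 1` is onto `E[p^∞]^{I}` under (ROOT)
(`exists_frob_smul_sub_eq_of_rootable`), so `m = φ b₀ − b₀`; `t = p^{k+1} b₀` is killed by `φ − 1`, hence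
`D_{𝔓₀}`-fixed (`smul_eq_of_mem_decompositionSubgroup_of_inertia_of_frob`), hence has a compatible
`I`-fixed root sequence `s` (`exists_divSeq_inertia_of_decomposition_fixed`); `a = (φ s_n − s_n)_n ∈ T_pE^{I}`
and `b = b₀ − s_{k+1}`.  (This is the vanishing of `(E[p^{k+1}]^{I}/π_{k+1} T^{I})^{φ = 1} ⊆ H¹(I_v, T_pE)^{Fr}[p^{k+1}]`,
i.e. of the `p`-part of the Tamagawa factor, Rubin Lemma 1.3.5 / Büyükboduk §2.1.2 Remark 2.)
[cite: Rubin2000, Lemma 1.3.5] [cite: GreenbergLNM1716, §3 Lemma 3.3 (p. 87) with the remark after its proof (p. 88)] -/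
theorem exists_tate_inertia_add_frob_sub_of_not_dvd_localTamagawaNumber {v : HeightOneSpectrum (𝓞 K)}
    (hpv : (p : 𝓞 K) ∉ v.asIdeal)
    (hc : ¬ p ∣ (W.baseChange (v.adicCompletion K)).localTamagawaNumber (v.adicCompletionIntegers K))
    {φ : absoluteGaloisGroup K} (hφ : IsArithFrobAt (𝓞 K) φ (adicCompletionPrime K v)) (k : ℕ)
    (m : W.geomPrimaryTorsion p)
    (hm : ∀ i ∈ (adicCompletionPrime K v).inertia (absoluteGaloisGroup K), i • m = m)
    (hmk : p ^ (k + 1) • m = 0) :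
    ∃ (a : W.tateModule p) (b : W.geomPrimaryTorsion p),
      (∀ i ∈ (adicCompletionPrime K v).inertia (absoluteGaloisGroup K), i • a = a) ∧
      (∀ i ∈ (adicCompletionPrime K v).inertia (absoluteGaloisGroup K), i • b = b) ∧
      p ^ (k + 1) • b = 0 ∧
      (m : geomPoints W) = TateModule.proj p (k + 1) a + (φ • (b : geomPoints W) - b) := by
  set I : Subgroup (absoluteGaloisGroup K) := (adicCompletionPrime K v).inertia (absoluteGaloisGroup K)
    with hIdef
  have hφD : φ ∈ (adicCompletionPrime K v).decompositionSubgroup (absoluteGaloisGroup K) :=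
    hφ.mem_stabilizer
  have hroot := rootable_adicCompletionPrime_of_not_dvd_localTamagawaNumber W p hpv hc
  -- `φ − 1` is onto `E[p^∞]^I`: `m = φ b₀ − b₀`
  obtain ⟨b₀, hb₀I, hb₀⟩ := exists_frob_smul_sub_eq_of_rootable W p hpv hroot hφ m hm
  -- `t = p^{k+1} b₀` is `I`-fixed and `φ`-fixed, hence `D_{𝔓₀}`-fixed
  set t : W.geomPrimaryTorsion p := p ^ (k + 1) • b₀ with htdef
  have htI : ∀ i ∈ I, i • t = t := fun i hi => by rw [htdef, smul_comm, hb₀I i hi]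
  have hφt : φ • t = t := by
    have h : φ • t - t = p ^ (k + 1) • (φ • b₀ - b₀) := by rw [htdef, smul_sub, smul_comm]
    rw [hb₀, hmk] at h
    exact sub_eq_zero.mp h
  have htD : ∀ d ∈ (adicCompletionPrime K v).decompositionSubgroup (absoluteGaloisGroup K), d • t = t :=
    fun d hd => smul_eq_of_mem_decompositionSubgroup_of_inertia_of_frob W p v hφ htI hφt hd
  -- compatible `I`-fixed root sequence of `t`
  obtain ⟨s, hs0, hs, hsI⟩ := exists_divSeq_inertia_of_decomposition_fixed W p hpv hc t htD
  have hspow : ∀ n, p ^ n • s n = t := by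
    intro n
    induction n with
    | zero => rw [pow_zero, one_smul, hs0]
    | succ n ih => rw [pow_succ, mul_smul, hs n, ih]
  -- the Tate vector `a = (φ s_n − s_n)_n`
  have hφI : ∀ i ∈ I, φ⁻¹ * i * φ ∈ I := fun i hi => inv_mul_mul_mem_inertia_adicCompletionPrime v hφD hi
  let a : W.tateModule p := TateModule.mk (fun n => φ • ((s n : W.geomPrimaryTorsion p) : geomPoints W) -
      ((s n : W.geomPrimaryTorsion p) : geomPoints W))
    (fun n => by
      have h := congrArg (fun z : W.geomPrimaryTorsion p => (z : geomPoints W)) (hspow n)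
      simp only [AddSubmonoidClass.coe_nsmul] at h
      rw [smul_sub, smul_comm, h]
      have h2 := congrArg (fun z : W.geomPrimaryTorsion p => (z : geomPoints W)) hφt
      rw [primaryComponent.coe_smul] at h2
      rw [h2, sub_self])
    (fun n => by
      have h := congrArg (fun z : W.geomPrimaryTorsion p => (z : geomPoints W)) (hs n)
      simp only [AddSubmonoidClass.coe_nsmul] at h
      rw [smul_sub, smul_comm, h])
  have ha : ∀ n, TateModule.proj p n a = φ • ((s n : W.geomPrimaryTorsion p) : geomPoints W) -
      ((s n : W.geomPrimaryTorsion p) : geomPoints W) := fun n => rfl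
  refine ⟨a, b₀ - s (k + 1), fun i hi => ?_, fun i hi => ?_, ?_, ?_⟩
  · -- `a` is `I`-fixed
    refine TateModule.ext fun n => ?_
    rw [TateModule.proj_smul_of_distribMulAction, ha, smul_sub]
    have h1 : i • ((s n : W.geomPrimaryTorsion p) : geomPoints W) = (s n : geomPoints W) := by
      have h := congrArg (fun z : W.geomPrimaryTorsion p => (z : geomPoints W)) (hsI n i hi)
      rwa [primaryComponent.coe_smul] at h
    have h2 : i • φ • ((s n : W.geomPrimaryTorsion p) : geomPoints W) = φ • (s n : geomPoints W) := by
      have e : i • φ • ((s n : W.geomPrimaryTorsion p) : geomPoints W) =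
          φ • ((φ⁻¹ * i * φ) • ((s n : W.geomPrimaryTorsion p) : geomPoints W)) := by
        rw [← mul_smul, ← mul_smul]; congr 1; group
      have h := congrArg (fun z : W.geomPrimaryTorsion p => (z : geomPoints W)) (hsI n _ (hφI i hi))
      rw [primaryComponent.coe_smul] at h
      rw [e, h]
    rw [h1, h2]
  · rw [smul_sub, hb₀I i hi, hsI (k + 1) i hi]
  · rw [smul_sub, hspow (k + 1), htdef, sub_self]
  · rw [ha (k + 1), AddSubgroup.coe_sub, smul_sub]
    have h := congrArg (fun z : W.geomPrimaryTorsion p => (z : geomPoints W)) hb₀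
    rw [AddSubgroup.coe_sub, primaryComponent.coe_smul] at h
    rw [← h]
    abel

end LocalAlgebra

/-! ### §2 `𝓕_u(w) = 𝓕_can(w) = H¹_ur(ℚ_w, E[p^{k+1}])` at a Tamagawa-free place `w ∤ p` of `ℚ` -/

section Structures

variable (W : WeierstrassCurve ℚ) [W.IsElliptic] (p : ℕ) [hp : Fact p.Prime] (k : ℕ)
  (w : HeightOneSpectrum (𝓞 ℚ))

/-- Local notation: `T_pE|_{Γ_{ℚ_w}}` (= `tateLocalRep W p (Sum.inr w)`, by `rfl`). -/
local notation3 "𝕋" => (GaloisRep.restrictField (HeightOneSpectrum.adicCompletion ℚ w)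
  (WeierstrassCurve.tateGaloisRep W p (W.continuous_galoisRepTate_holds p)).toIntRep)
/-- Local notation: `E[p^k · p]|_{Γ_{ℚ_w}}` (= `(W.torsionGaloisModule (p^k · p)).toLocal (Sum.inr w)`). -/
local notation3 "𝕄" => (GaloisRep.restrictField (HeightOneSpectrum.adicCompletion ℚ w)
  (W.torsionGaloisModule ((p : ℤ) ^ k * (p : ℤ))))

omit [W.IsElliptic] hp in
/-- Unfolding the local action on `E[p^k · p]|_{Γ_{ℚ_w}}` down to geometric points:
`(σ · P) = res(σ) • P`. [folklore] -/
theorem coe_toTopRep_torsion_ρ_apply (σ : absoluteGaloisGroup (w.adicCompletion ℚ))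
    (P : geomTorsion W ((p : ℤ) ^ k * (p : ℤ))) :
    (((DiscreteGaloisModule.toTopRep 𝕄).ρ σ P : geomTorsion W ((p : ℤ) ^ k * (p : ℤ))) : geomPoints W) =
      absGaloisRestrict ℚ (w.adicCompletion ℚ) σ • (P : geomPoints W) := rfl

omit [W.IsElliptic] hp in
/-- The same for the module written as a restriction (`GaloisRep.restrictField`). [folklore] -/
theorem coe_restrictField_torsion_apply (σ : absoluteGaloisGroup (w.adicCompletion ℚ))
    (P : geomTorsion W ((p : ℤ) ^ k * (p : ℤ))) :
    (((𝕄) σ P : geomTorsion W ((p : ℤ) ^ k * (p : ℤ))) : geomPoints W) =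
      absGaloisRestrict ℚ (w.adicCompletion ℚ) σ • (P : geomPoints W) := rfl

/-- **The local `𝓕_u` lift at a Tamagawa-free place.**  At a finite `w ∤ p` with `p ∤ c_w`, every
continuous cocycle `ψ : Γ_{ℚ_w} → E[p^k · p]` VANISHING on `I_w` has class `π_{k+1,*} y` for an unramified
`y ∈ H¹(ℚ_w, T_pE)` (`res_{I_w} y = 0`): its value at a Frobenius lift `φ` is `I_w`-fixed
(`apply_mem_invariants_of_vanishing`), hence `= a_{k+1} + (φ b − b)` with `a ∈ T_pE^{I_w}`, `b ∈ E[p^k·p]^{I_w}`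
(§1, through `D_{𝔓₀} = res Γ_{ℚ_w}`, `I_{𝔓₀} = res I_w`); `ψ − ∂b` vanishes on `I_w` with `φ`-value
`a_{k+1}`, so gen 2's `exists_unramified_tateLocalMap_eq_of_vanishing_inertia` applies.
[cite: MazurRubin2004, App. A Remark A.5 (p. 81)] [cite: Rubin2000, Lemma 1.3.2, Lemma 1.3.5] -/
theorem exists_unramified_tateLocalMap_eq_of_vanishing_inertia_of_not_dvd_localTamagawaNumber
    (hw : ((p : ℕ) : 𝓞 ℚ) ∉ w.asIdeal)
    (hc : ¬ p ∣ (W.baseChange (w.adicCompletion ℚ)).localTamagawaNumber (w.adicCompletionIntegers ℚ))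
    (ψ : contOneCocycles (DiscreteGaloisModule.toTopRep 𝕄))
    (hψI : ∀ n : absInertia (w.adicCompletion ℚ), ψ.1 n = 0) :
    ∃ y : (tateLocalRep W p (Sum.inr w)).cohomology 1,
      resSubgroup (tateLocalRep W p (Sum.inr w)).toTopRep (absInertia (w.adicCompletion ℚ)) 1 y = 0 ∧
        tateLocalMap W p k (Sum.inr w) y = oneCocycleClass _ ψ := by
  set F := w.adicCompletion ℚ with hFdef
  set θ : absoluteGaloisGroup F →ₜ* absoluteGaloisGroup ℚ := absGaloisRestrict ℚ F with hθdef
  set 𝔓₀ : Ideal (absIntegers (𝓞 ℚ) ℚ) := adicCompletionPrime ℚ w with h𝔓₀def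
  haveI : (absInertia F).Normal := absInertia_normal_holds F
  have hθI : ∀ u ∈ absInertia F, θ u ∈ 𝔓₀.inertia (absoluteGaloisGroup ℚ) := fun u hu => by
    rw [h𝔓₀def, inertia_adicCompletionPrime_eq_map_absInertia]; exact Subgroup.mem_map_of_mem _ hu
  obtain ⟨φ, hφ⟩ := exists_isFrobPow_holds (F := F) 1
  have hφ' : IsArithFrobAt (𝓞 ℚ) (θ φ) 𝔓₀ := isArithFrobAt_absGaloisRestrict_of_isFrobPow_one w hφ
  -- the value `m₀ = ψ(φ)`, as a point of `E[p^∞]`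
  set m₀ : geomTorsion W ((p : ℤ) ^ k * (p : ℤ)) := ψ.1 φ with hm₀def
  have hpow : ∀ P : geomPoints W, P ∈ geomTorsion W ((p : ℤ) ^ k * (p : ℤ)) →
      p ^ (k + 1) • P = 0 := fun P hP => by
    have h := (mem_geomTorsion_pow_mul_iff W p k P).mp hP
    rwa [mem_geomTorsion_iff, natCast_zsmul] at h
  have hprim : ∀ P : geomPoints W, P ∈ geomTorsion W ((p : ℤ) ^ k * (p : ℤ)) → P ∈ W.geomPrimaryTorsion p :=
    fun P hP => (AddCommGroup.mem_primaryComponent).mpr ⟨k + 1, hpow P hP⟩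
  let m : W.geomPrimaryTorsion p := ⟨(m₀ : geomPoints W), hprim _ m₀.2⟩
  -- `ψ(φ)` is `I_w`-fixed
  have hψinv : ∀ n : absInertia F, (DiscreteGaloisModule.toTopRep 𝕄).ρ (n : absoluteGaloisGroup F) m₀ = m₀ :=
    fun n => apply_mem_invariants_of_vanishing (DiscreteGaloisModule.toTopRep 𝕄) ψ hψI φ n
  have hmI : ∀ i ∈ 𝔓₀.inertia (absoluteGaloisGroup ℚ), i • m = m := by
    refine (forall_inertia_adicCompletionPrime_smul_eq_iff W p w m).mpr fun τ hτ => Subtype.ext ?_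
    have h := congrArg (fun z : geomTorsion W ((p : ℤ) ^ k * (p : ℤ)) => (z : geomPoints W)) (hψinv ⟨τ, hτ⟩)
    rw [coe_toTopRep_torsion_ρ_apply] at h
    rw [primaryComponent.coe_smul]
    exact h
  have hmk : p ^ (k + 1) • m = 0 := Subtype.ext (by
    rw [AddSubmonoidClass.coe_nsmul, ZeroMemClass.coe_zero]; exact hpow _ m₀.2)
  -- §1: `m = a_{k+1} + (φ b − b)`
  obtain ⟨a, b, haI, hbI, hbk, hab⟩ :=
    exists_tate_inertia_add_frob_sub_of_not_dvd_localTamagawaNumber W p hw hc hφ' k m hmI hmk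
  -- `b` as a point of `E[p^k · p]`
  have hbmem : (b : geomPoints W) ∈ geomTorsion W ((p : ℤ) ^ k * (p : ℤ)) := by
    rw [mem_geomTorsion_pow_mul_iff, mem_geomTorsion_iff, natCast_zsmul]
    have h := congrArg (fun z : W.geomPrimaryTorsion p => (z : geomPoints W)) hbk
    simpa only [AddSubmonoidClass.coe_nsmul, ZeroMemClass.coe_zero] using h
  let β : geomTorsion W ((p : ℤ) ^ k * (p : ℤ)) := ⟨(b : geomPoints W), hbmem⟩
  have hβI : ∀ n : absInertia F, (DiscreteGaloisModule.toTopRep 𝕄).ρ (n : absoluteGaloisGroup F) β = β := by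
    intro n
    have h := (forall_inertia_adicCompletionPrime_smul_eq_iff W p w b).mp hbI n n.2
    have h' := congrArg (fun z : W.geomPrimaryTorsion p => (z : geomPoints W)) h
    rw [primaryComponent.coe_smul] at h'
    exact Subtype.ext (by rw [coe_toTopRep_torsion_ρ_apply]; exact h')
  -- the corrected cocycle `ψ' = ψ − ∂β`
  have hβc : Continuous fun g : absoluteGaloisGroup F => (DiscreteGaloisModule.toTopRep 𝕄).ρ g β :=
    (𝕄).continuous_apply_left β
  let δ : contOneCocycles (DiscreteGaloisModule.toTopRep 𝕄) := principalCocycle _ β hβc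
  let ψ' : contOneCocycles (DiscreteGaloisModule.toTopRep 𝕄) := ψ - δ
  have hψ'apply : ∀ g, ψ'.1 g = ψ.1 g - ((DiscreteGaloisModule.toTopRep 𝕄).ρ g β - β) := fun g => by
    change (ψ.1 - δ.1) g = _
    rw [ContinuousMap.sub_apply, principalCocycle_apply]
  have hψ'I : ∀ n : absInertia F, ψ'.1 n = 0 := fun n => by
    rw [hψ'apply, hψI n, hβI n, sub_self, sub_zero]
  have hψ'φ : ((ψ'.1 φ : geomTorsion W ((p : ℤ) ^ k * (p : ℤ))) : geomPoints W) =
      TateModule.proj p (k + 1) a := by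
    rw [hψ'apply, AddSubgroupClass.coe_sub, AddSubgroupClass.coe_sub, coe_toTopRep_torsion_ρ_apply, ← hm₀def]
    have e : ((m₀ : geomTorsion W ((p : ℤ) ^ k * (p : ℤ))) : geomPoints W) = (m : geomPoints W) := rfl
    rw [e, hab]
    change _ - (θ φ • (b : geomPoints W) - (b : geomPoints W)) = _
    abel
  have haI' : ∀ n : absInertia F, (𝕋).toTopRep.ρ (n : absoluteGaloisGroup F) a = a := fun n => by
    change (θ n) • a = a
    exact haI _ (hθI n n.2)
  obtain ⟨y, hyI, hy⟩ := exists_unramified_tateLocalMap_eq_of_vanishing_inertia W p k w hφ ψ' hψ'I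
    ⟨a, haI', hψ'φ⟩
  refine ⟨y, hyI, ?_⟩
  rw [hy]
  change oneCocycleClass _ (ψ - δ) = _
  rw [oneCocycleClass_sub, oneCocycleClass_principalCocycle, sub_zero]

end Structures

end Summit.BirchSwinnertonDyer.BirchSwinnertonDyer.Theorems.KimAtThreeD7uTamagawaFreePlaces

end
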